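import Summits.NavierStokesRegularity.NavierStokesRegularity.Theorems.OddMorawetzLocal.Negative.OddMorawetzLocalRefutationDefsIV
import Summits.NavierStokesRegularity.NavierStokesRegularity.Theorems.OddMorawetzOddMorawetzLocalActFunctorial
import Summits.NavierStokesRegularity.NavierStokesRegularity.Theorems.OddMorawetzOddMorawetzLocalCoeffSemantics
import Summits.NavierStokesRegularity.NavierStokesRegularity.Theorems.OddMorawetzOddMorawetzLocalIdxComplete
import HarnessLib

/-!
# The derivation matrix acts on coefficient vectors as `der` acts on polynomials; the integer system of step E2

Crux `OddMorawetzLocal` (item stmt-NavierStokesRegularity-1376), refutation skeleton, registered stubs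
`derMatrix_mulVec_vecOf` and `aMatrix_mulVec_eq` (step E2, algebra).  Pure list / `Finset` algebra over the
computable jet algebra (`OddMorawetzLocal/Negative/OddMorawetzLocalJetAlgebra.lean`, `…RefutationDefs.lean`,
`…RefutationDefsIV.lean`); Mathlib plus the landed `coeffOf_derP` / `derMatrix_map` (`…ActFunctorial`),
`coeffOf_cons` / `coeffOf_append` / `coeffOf_smul` / `coeffOf_nil` (`…CoeffSemantics`) and `canonical_of_mem_idx` /
`mem_idx_of_canonical` / `nodup_idx` (`…IdxComplete`); no named facts, no new definitions.

After `B₃`-averaging, the certificate's coefficient vector is `τ = Σ_r c_r · vecOf k (orbitSumN reps_r)` and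
infinitesimal rotation invariance gives `derMatrix k lieZ *ᵥ τ = 0`.  This file converts that into the INTEGER linear
system `aMatrix k reps *ᵥ c = 0` of the modular rank certificate:

* `coeffOf_der_cons`, `coeffOf_der_eq_sum` — the derivation `der L` is a `flatMap` over the terms, each term `(c, m)`
  contributing `c •` the derivation of the monic term `(1, m)`; for a polynomial `q` whose monomials are basis
  monomials of weight `k` the term sum regroups over the duplicate-free basis `idx k` (`nodup_idx`):
  `coeffOf (der L q) μ = Σ_j coeffOf (der L [(1, idx_j)]) μ · coeffOf q idx_j`;
* `derMatrix_mulVec_vecOf` — read with `μ = idx_i` this is `(derMatrix k L *ᵥ vecOf k q) i = coeffOf (der L q) idx_i`;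
* `snd_mem_norm`, `permAct_snd_mem_idx`, `mem_idx_of_mem_orbitSumN` — the monomials of a normal form `norm p` are
  `sortVars` of monomials of `p`, the signed-permutation image of a basis monomial is a basis monomial (canonical
  of the same length, orders and weight), hence every monomial of `orbitSumN m`, `m ∈ idx k`, is in `idx k`;
* `aMatrix_mulVec_eq` — entrywise, `aMatrix k reps i r = coeffOf (derP lieZ (orbitSumN reps_r)) idx_i` equals
  (`coeffOf_derP`, `derMatrix_mulVec_vecOf`) the `i`-th entry of `derMatrix k lieZ *ᵥ vecOf k (orbitSumN reps_r)`
  over `ℤ`, and the real derivation matrix of `lieZ` is the cast of the integer one (`derMatrix_map`), so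
  `(aMatrix k reps : ℝ) *ᵥ c = derMatrix k lieZ *ᵥ (Σ_r c_r • vecOf k (orbitSumN reps_r))`.
-/

noncomputable section

set_option linter.dupNamespace false
set_option autoImplicit false

namespace Summit.NavierStokesRegularity.NavierStokesRegularity.Theorems.OddMorawetz

open CoeffSemantics

namespace E2Algebra

/-! ### `der` is linear over the list of terms -/

/-- `der` of a single term `(c, m)` is `der` of the monic term `(1, m)` with all coefficients scaled by `c`. -/
theorem der_singleton_eq_map {R : Type} [CommRing R] (L : Matrix (Fin 3) (Fin 3) R) (c : R) (m : List JVar) :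
    JPoly.der L [(c, m)] = (JPoly.der L [(1, m)]).map fun t => (c * t.1, t.2) := by
  simp [JPoly.der, List.map_flatMap, Function.comp_def]

/-- `der` of a cons splits off the derivation of the head term. -/
theorem der_cons {R : Type} [CommRing R] (L : Matrix (Fin 3) (Fin 3) R) (t : R × List JVar) (q : JPoly R) :
    JPoly.der L (t :: q) = JPoly.der L [t] ++ JPoly.der L q := by
  simp [JPoly.der]

/-- The coefficients of `der L ((c, m) :: q)`: `c ·` those of `der L [(1, m)]` plus those of `der L q`. -/
theorem coeffOf_der_cons {R : Type} [CommRing R] (L : Matrix (Fin 3) (Fin 3) R) (c : R) (m : List JVar)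
    (q : JPoly R) (μ : List JVar) :
    JPoly.coeffOf (JPoly.der L ((c, m) :: q)) μ =
      c * JPoly.coeffOf (JPoly.der L [(1, m)]) μ + JPoly.coeffOf (JPoly.der L q) μ := by
  rw [der_cons, coeffOf_append, der_singleton_eq_map]
  congr 1
  exact coeffOf_smul c _ μ

/-- **Regrouping the derivation by the basis.**  For a polynomial all of whose monomials are basis monomials of
weight `k`, `coeffOf (der L q) μ = Σ_j coeffOf (der L [(1, idx_j)]) μ · coeffOf q idx_j` (the basis `idx k` is
duplicate-free). -/
theorem coeffOf_der_eq_sum {R : Type} [CommRing R] (k : ℕ) (L : Matrix (Fin 3) (Fin 3) R) (μ : List JVar) :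
    ∀ q : JPoly R, (∀ t ∈ q, t.2 ∈ idx k) →
      JPoly.coeffOf (JPoly.der L q) μ =
        ∑ j, JPoly.coeffOf (JPoly.der L [(1, (idx k).get j)]) μ * JPoly.coeffOf q ((idx k).get j)
  | [], _ => by simp [JPoly.der, coeffOf_nil]
  | (c, m) :: q, hq => by
    have hm : m ∈ idx k := hq (c, m) List.mem_cons_self
    obtain ⟨j₀, hj₀⟩ := List.get_of_mem hm
    have hinj : Function.Injective (idx k).get := List.nodup_iff_injective_get.1 (nodup_idx k)
    rw [coeffOf_der_cons, coeffOf_der_eq_sum k L μ q (fun t ht => hq t (List.mem_cons_of_mem _ ht))]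
    simp only [coeffOf_cons, mul_add, Finset.sum_add_distrib]
    congr 1
    rw [Finset.sum_eq_single j₀]
    · rw [if_pos hj₀, hj₀, mul_comm]
    · intro j _ hj
      rw [if_neg (fun h => hj (hinj (h.trans hj₀.symm))), mul_zero]
    · intro h
      exact absurd (Finset.mem_univ j₀) h

/-! ### Monomials of normal forms and of orbit sums -/

/-- A monomial of `insertTerm c m₀ q` is `m₀` or a monomial of `q`. -/
theorem snd_mem_insertTerm {R : Type} [Add R] (c : R) (m₀ : List JVar) :
    ∀ (q : JPoly R) (t : R × List JVar), t ∈ JPoly.insertTerm c m₀ q → t.2 = m₀ ∨ ∃ s ∈ q, t.2 = s.2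
  | [], t, ht => by
    simp only [JPoly.insertTerm, List.mem_singleton] at ht
    exact Or.inl (by rw [ht])
  | (c', m') :: rest, t, ht => by
    cases hc : monoCmp m₀ m' with
    | lt =>
      simp only [JPoly.insertTerm, hc, List.mem_cons] at ht
      rcases ht with rfl | rfl | ht
      · exact Or.inl rfl
      · exact Or.inr ⟨(c', m'), List.mem_cons_self, rfl⟩
      · exact Or.inr ⟨t, List.mem_cons_of_mem _ ht, rfl⟩
    | eq =>
      simp only [JPoly.insertTerm, hc, List.mem_cons] at ht
      rcases ht with rfl | ht
      · exact Or.inr ⟨(c', m'), List.mem_cons_self, rfl⟩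
      · exact Or.inr ⟨t, List.mem_cons_of_mem _ ht, rfl⟩
    | gt =>
      simp only [JPoly.insertTerm, hc, List.mem_cons] at ht
      rcases ht with rfl | ht
      · exact Or.inr ⟨(c', m'), List.mem_cons_self, rfl⟩
      · rcases snd_mem_insertTerm c m₀ rest t ht with h | ⟨s, hs, h⟩
        · exact Or.inl h
        · exact Or.inr ⟨s, List.mem_cons_of_mem _ hs, h⟩

/-- A monomial of `collect p` is `sortVars` of a monomial of `p`. -/
theorem snd_mem_collect {R : Type} [Add R] :
    ∀ (p : JPoly R) (t : R × List JVar), t ∈ JPoly.collect p → ∃ s ∈ p, t.2 = sortVars s.2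
  | [], t, ht => by simp [JPoly.collect] at ht
  | s :: p, t, ht => by
    change t ∈ JPoly.insertTerm s.1 (sortVars s.2) (JPoly.collect p) at ht
    rcases snd_mem_insertTerm s.1 (sortVars s.2) (JPoly.collect p) t ht with h | ⟨u, hu, h⟩
    · exact ⟨s, List.mem_cons_self, h⟩
    · obtain ⟨s', hs', h'⟩ := snd_mem_collect p u hu
      exact ⟨s', List.mem_cons_of_mem _ hs', h.trans h'⟩

/-- A monomial of the normal form `norm p` is `sortVars` of a monomial of `p`. -/
theorem snd_mem_norm {R : Type} [Add R] [Zero R] [DecidableEq R] (p : JPoly R) (t : R × List JVar)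
    (ht : t ∈ JPoly.norm p) : ∃ s ∈ p, t.2 = sortVars s.2 := by
  unfold JPoly.norm at ht
  exact snd_mem_collect p t (List.mem_filter.1 ht).1

/-- Sorting preserves the length of an index list. -/
theorem length_sortIdx_eq (l : List (Fin 3)) : (sortIdx l).length = l.length := by
  rw [sortIdx_eq_insertionSort, List.length_insertionSort]

/-- `sortIdx` is idempotent. -/
theorem sortIdx_idem (l : List (Fin 3)) : sortIdx (sortIdx l) = sortIdx l :=
  (sortIdx_eq_self_iff _).2 (by rw [sortIdx_eq_insertionSort]; exact List.pairwise_insertionSort _ _)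

/-- **The signed-permutation image of a basis monomial is a basis monomial**: it is `sortVars`-sorted, has the
three variables `(σ⁻¹ a, sortIdx (σ⁻¹ l))` with sorted index lists of the original orders, and the same weight. -/
theorem permAct_snd_mem_idx (σ : Equiv.Perm (Fin 3)) (ε : Fin 3 → Bool) {k : ℕ} {m : List JVar}
    (hm : m ∈ idx k) : (permAct σ ε m).2 ∈ idx k := by
  obtain ⟨-, hlen, hcan, hw⟩ := canonical_of_mem_idx hm
  have hp := perm_sortVars (m.map fun v => (permActVar σ ε v).2)
  show sortVars (m.map fun v => (permActVar σ ε v).2) ∈ idx k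
  refine mem_idx_of_canonical (sortVars_sortVars _) ?_ (fun v hv => ?_) ?_
  · rw [hp.length_eq, List.length_map, hlen]
  · obtain ⟨u, hu, rfl⟩ := List.mem_map.1 (hp.subset hv)
    show sortIdx (sortIdx (u.2.map σ.symm)) = sortIdx (u.2.map σ.symm) ∧ (sortIdx (u.2.map σ.symm)).length ≤ 3
    rw [length_sortIdx_eq, List.length_map]
    exact ⟨sortIdx_idem _, (hcan u hu).2⟩
  · unfold monoWeight at hw ⊢
    rw [(hp.map _).sum_eq, List.map_map, ← hw]
    congr 1
    refine List.map_congr_left fun u _ => ?_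
    simp [permActVar, length_sortIdx_eq]

/-- **Orbit sums stay on the basis.**  Every monomial of `orbitSumN m`, `m ∈ idx k`, is a basis monomial. -/
theorem mem_idx_of_mem_orbitSumN {k : ℕ} {m : List JVar} (hm : m ∈ idx k) :
    ∀ t ∈ orbitSumN m, t.2 ∈ idx k := by
  intro t ht
  unfold orbitSumN at ht
  obtain ⟨t', ht', rfl⟩ := List.mem_map.1 ht
  unfold orbitSum at ht'
  obtain ⟨s, hs, hts⟩ := snd_mem_norm _ t' ht'
  obtain ⟨g, -, rfl⟩ := List.mem_map.1 hs
  have h2 : t'.2 = (permAct g.1 g.2 m).2 := by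
    rw [hts]
    exact sortVars_sortVars _
  show t'.2 ∈ idx k
  rw [h2]
  exact permAct_snd_mem_idx g.1 g.2 hm

/-! ### The real derivation matrix of `lieZ` is the cast of the integer one -/

/-- The integer generator `lieZ` casts to the real one. -/
theorem lieZ_map_intCast :
    (lieZ : Matrix (Fin 3) (Fin 3) ℤ).map (Int.castRingHom ℝ) = (lieZ : Matrix (Fin 3) (Fin 3) ℝ) := by
  ext i j
  simp only [lieZ, Matrix.map_apply, Matrix.of_apply]
  split_ifs <;> simp

/-- Entrywise, `derMatrix k (lieZ : ℝ)` is the cast of `derMatrix k (lieZ : ℤ)` (functoriality `derMatrix_map`). -/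
theorem derMatrix_lieZ_real_apply (k : ℕ) (i j : Fin (idx k).length) :
    derMatrix k (lieZ : Matrix (Fin 3) (Fin 3) ℝ) i j = ((derMatrix k (lieZ : Matrix (Fin 3) (Fin 3) ℤ) i j : ℤ) : ℝ) := by
  rw [← lieZ_map_intCast, derMatrix_map]
  simp only [Matrix.map_apply, eq_intCast]

end E2Algebra

open E2Algebra

/-! ### The registered stubs -/

/-- **Stub `derMatrix_mulVec_vecOf` (refutation of `OddMorawetzLocal`, step E2 algebra).**  The derivation matrix
acts on the coefficient vector of an integer polynomial on the basis as the derivation acts on the polynomial: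
`(derMatrix k L *ᵥ vecOf k q) i = coeffOf (der L q) (idx k)_i` whenever every monomial of `q` is a basis monomial. -/
theorem derMatrix_mulVec_vecOf (k : ℕ) (L : Matrix (Fin 3) (Fin 3) ℤ) (q : JPoly ℤ) (hq : ∀ t ∈ q, t.2 ∈ idx k)
    (i : Fin (idx k).length) :
    ((derMatrix k L).mulVec (vecOf k q)) i = JPoly.coeffOf (JPoly.der L q) ((idx k).get i) := by
  rw [Matrix.mulVec_apply_eq_sum, coeffOf_der_eq_sum k L _ q hq]
  rfl

/-- **Stub `aMatrix_mulVec_eq` (refutation of `OddMorawetzLocal`, step E2 algebra).**  The integer matrix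
`aMatrix k reps` of the derivation `der lieZ` on the normalised orbit sums, cast to `ℝ` and applied to `c`, is the
real derivation matrix of `lieZ` applied to the orbit expansion `Σ_r c_r • vecOf k (orbitSumN reps_r)`. -/
theorem aMatrix_mulVec_eq (k : ℕ) (reps : List (List JVar)) (hr : ∀ m ∈ reps, m ∈ idx k) (c : Fin reps.length → ℝ) :
    ((aMatrix k reps).map (Int.cast : ℤ → ℝ)).mulVec c =
      (derMatrix k (lieZ : Matrix (Fin 3) (Fin 3) ℝ)).mulVec (∑ r, c r • fun j => ((vecOf k (orbitSumN (reps.get r)) j : ℤ) : ℝ)) := by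
  funext i
  -- the integer identity, one representative at a time
  have key : ∀ r : Fin reps.length, aMatrix k reps i r =
      ∑ j, derMatrix k (lieZ : Matrix (Fin 3) (Fin 3) ℤ) i j * vecOf k (orbitSumN (reps.get r)) j := by
    intro r
    rw [← Matrix.mulVec_apply_eq_sum,
      derMatrix_mulVec_vecOf k lieZ _ (mem_idx_of_mem_orbitSumN (hr _ (List.get_mem reps r))) i]
    simp only [aMatrix, Matrix.of_apply]
    exact coeffOf_derP _ _ _
  rw [Matrix.mulVec_apply_eq_sum, Matrix.mulVec_apply_eq_sum]
  simp only [Matrix.map_apply, key, Int.cast_sum, Int.cast_mul, Finset.sum_mul, Finset.sum_apply, Pi.smul_apply,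
    smul_eq_mul, derMatrix_lieZ_real_apply, Finset.mul_sum]
  rw [Finset.sum_comm]
  exact Finset.sum_congr rfl fun j _ => Finset.sum_congr rfl fun r _ => by ring

end Summit.NavierStokesRegularity.NavierStokesRegularity.Theorems.OddMorawetz

end
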